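/-
Copyright: statement-level skeleton of a published paper (lit-balaban cell, Phase-2 proof seat p25, gen 18). No proof
claims beyond what the kernel checks below.
-/
import Literature.MathematicalPhysics.QuantumFieldTheory.BalabanImbrieJaffe1984to88.BIJ88WalkGeometry311
import Literature.MathematicalPhysics.QuantumFieldTheory.BalabanImbrieJaffe1984to88.BIJ88WalkExpansion311

/-!
# `BalabanImbrieJaffe1984to88.BIJ88WalkExpansionGeo311` — T. Bałaban, J. Imbrie, A. Jaffe, *Effective action and
cluster properties of the abelian Higgs model*, Commun. Math. Phys. **114** (1988) 257–315 [BalabanImbrieJaffe1988],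
§5.14 p. 311 [PDF 55] *"For each term, let X be the union of the cubes covering the X_{σ_i} and the regions from the
random walk expansion. A connected component of X … We break up the observable according to the connected components
of X."* — **THE GEOMETRY OF THE TERMS OF THE EXPANSION WITH THE COVARIANCE SPLIT** (p25 gen 18): when the pieces link
the cubes they contract (`BIJ88WalkGeometry311.run_conn`), EVERY BLOCK `X_c` AND EVERY REMAINDER COMPONENT `X_r` OF
EVERY NONDEGENERATE TERM of `BIJ88WalkExpansion311.expand` IS AN `R`-CONNECTED SET OF CUBES carrying all its pending
legs (`expand_geo`) — the polymers of the p. 312 display.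

statement-level skeleton of published theorems with citation tags; proofs where landed; nothing here is a claim
about the Yang–Mills mass gap

PDF held: `paper:balaban1988-cmp114-bij-abelian-higgs-effective-action` (journal page = PDF page + 256); p. 311–312 =
PDF 55–56 (`p0055.txt` L23–38, `p0056.txt` L1–9 re-read this session, 2026-08-22).

CITATION HEADER (lean-in-tree rule).  lit-balaban cell (HOME `run/shared/lean/pub/lit-balaban/`), Phase 2, seat p25
gen 18; row **C2.Claim@312** of `HOME/lit-balaban-r16/ROWS-C2-part2.md` (owner r16, referee ref-5; head
`BIJ88Sect5StatementsPart4.Ineq312` untouched).  USED BY NAME, nothing restated: `BIJ88WalkRun311.{WGrp, WOut, run,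
pristine}`, `BIJ88WalkRunEnv311.{run_rest_subset, run_done_le}`, `BIJ88WalkGeometry311.{Geo, Nondeg, cubes,
run_conn_pristine}`, `BIJ88WalkExpansion311.{WTerm, oact, expand, expand_of_nonempty, expand_of_not_nonempty}` (this
seat and generation), `BIJ88LabelledRun311.mem_mbind` (p25 gen 16), `Literature.Probability.LatticeModels.IsRConnected`.

## What is proved (0 `sorry`, standard axioms, no new `Prop` facts; definition with body: `NondegT`)

* `NondegT` (nonzero coefficient and `χ′`-directions), `nondeg_of_oact`, **`expand_geo`** (every block and every
  remainder component of every nondegenerate term satisfies `Geo`), `expand_geo_init`,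
  `isRConnected_cubes_of_mem_consts` / `isRConnected_cubes_of_mem_groups` (the polymer form).
HONEST SCOPE: as in `BIJ88WalkGeometry311` — contraction-graph components (print's geometric components of `X` are
unions of ours), pieces/regions/adjacency are data with the two linking hypotheses; connectedness only (no tree decay,
no Kotecký–Preiss currency, no estimate); zero-coefficient terms are not claimed connected.  NOT summit progress; NOT
continuum; NOT Clay.  Imports `BIJ88WalkGeometry311`, `BIJ88WalkExpansion311`; modifies nothing.
-/

noncomputable section

namespace Literature.MathematicalPhysics.QuantumFieldTheory.BalabanImbrieJaffe1984to88.BIJ88WalkExpansionGeo311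

open Classical Matrix Finset
open scoped BigOperators
open Literature.Probability.LatticeModels (IsRConnected)
open BIJ88LabelledRun311 (mbind mem_mbind)
open BIJ88WalkRun311 BIJ88WalkRunEnv311 BIJ88WalkGeometry311 BIJ88WalkExpansion311

variable {S : Type} [Fintype S] {ι : Type} [Fintype ι] {κ : Type} [LinearOrder κ] {P : Type} [Fintype P]
  {Cov : P → Matrix S S ℝ} {trig : P → Bool} {f : S → ℝ} {c : ι → ℝ} {legs : ι → List (S → ℝ)}
  {obs : κ → List (S → ℝ)} {M : ℕ}

/-! ## The geometry of the terms: every block and every remainder component is `R`-connected -/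

/-- **A nondegenerate term**: nonzero coefficient and nonzero `χ′`-directions. [cite: BalabanImbrieJaffe1988, §5.14 p.311] -/
def NondegT (t : WTerm S κ ι P) : Prop := t.coef ≠ 0 ∧ ∀ z ∈ t.dirs, z ≠ 0

section Geometry

variable {β : Type} [DecidableEq β] {oc : κ → Finset β} {vc : ι → Finset β} {reg : P → Finset β}
  {R : β → β → Prop} {lc : (S → ℝ) → β}

omit [Fintype S] [Fintype ι] [LinearOrder κ] [Fintype P] in
/-- An outcome acting on a nondegenerate term is nondegenerate, and so is the term (bookkeeping).
[cite: BalabanImbrieJaffe1988, §5.14 p.311] -/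
theorem nondeg_of_oact {o : WOut S κ ι P} {t : WTerm S κ ι P} (h : NondegT (oact o t)) : Nondeg o ∧ NondegT t := by
  rcases h with ⟨hc, hd⟩
  simp only [oact_coef, oact_dirs, List.mem_append] at hc hd
  exact ⟨⟨left_ne_zero_of_mul hc, fun z hz => hd z (Or.inl hz)⟩, right_ne_zero_of_mul hc, fun z hz => hd z (Or.inr hz)⟩

/-- **EVERY BLOCK AND EVERY REMAINDER COMPONENT OF A NONDEGENERATE TERM IS AN `R`-CONNECTED SET OF CUBES** (p. 311:
*"X … the union of the cubes covering the X_{σ_i} and the regions from the random walk expansion. A connected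
component of X …"*): under the linking hypotheses of `BIJ88WalkGeometry311.run_conn` on the pieces and the
localization hypotheses on observables and vertices, from `Geo` components set aside every nondegenerate term of
`expand done rest` has `Geo` blocks and `Geo` set-aside components — each `X_c`, `X_r` is `R`-connected and carries the
cubes of all its pending legs. [cite: BalabanImbrieJaffe1988, §5.14 p.311–312] -/
theorem expand_geo
    (hlink : ∀ p u w, (Cov p *ᵥ u) ⬝ᵥ w ≠ 0 → IsRConnected R (insert (lc u) (insert (lc w) (reg p))))
    (hhalf : ∀ p u, Cov p *ᵥ u ≠ 0 → IsRConnected R (insert (lc u) (reg p)))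
    (hocc : ∀ j, IsRConnected R (oc j)) (hobs : ∀ j, ∀ w ∈ obs j, lc w ∈ oc j)
    (hvcc : ∀ m, IsRConnected R (vc m)) (hlegs : ∀ m, ∀ w ∈ legs m, lc w ∈ vc m) :
    ∀ (n : ℕ) (done : Multiset (WGrp S κ ι P)) (rest : Finset κ), rest.card < n →
      (∀ h ∈ done, Geo oc vc reg R lc h) → ∀ t ∈ expand Cov trig f c legs obs M done rest, NondegT t →
        (∀ g ∈ t.consts, Geo oc vc reg R lc g) ∧ ∀ g ∈ t.groups, Geo oc vc reg R lc g
  | 0, _, _, hn => fun _ _ _ => absurd hn (Nat.not_lt_zero _)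
  | n + 1, done, rest, hn => by
    intro hd t ht hnd
    by_cases h : rest.Nonempty
    · rw [expand_of_nonempty Cov trig f c legs obs M h, mem_mbind] at ht
      obtain ⟨o, ho, ht⟩ := ht
      have hcard : o.rest.card < n := lt_of_lt_of_le (lt_of_le_of_lt (Finset.card_le_card (run_rest_subset _ _ _ o ho))
        (Finset.card_erase_lt_of_mem (rest.min'_mem h))) (Nat.lt_succ_iff.1 hn)
      have hrun := run_conn_pristine (trig := trig) (f := f) (c := c) (M := M) hlink hhalf hocc hobs hvcc hlegs
        (rest.min' h) (rest.erase (rest.min' h)) hd o ho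
      split_ifs at ht with hg
      · rw [Multiset.mem_map] at ht
        obtain ⟨t', ht', rfl⟩ := ht
        have hnd' : Nondeg o ∧ NondegT t' := by
          have h' : NondegT (oact o t') := by simpa [NondegT] using hnd
          exact nondeg_of_oact h'
        obtain ⟨hgo, hdo⟩ := hrun hnd'.1
        obtain ⟨h1, h2⟩ := expand_geo hlink hhalf hocc hobs hvcc hlegs n o.done o.rest hcard hdo t' ht' hnd'.2
        refine ⟨fun g hg' => ?_, h2⟩
        simp only [WTerm.addConst_consts, oact_consts, Multiset.mem_cons] at hg'
        rcases hg' with rfl | hg'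
        · exact hgo
        · exact h1 g hg'
      · rw [Multiset.mem_map] at ht
        obtain ⟨t', ht', rfl⟩ := ht
        have hnd' : Nondeg o ∧ NondegT t' := nondeg_of_oact hnd
        obtain ⟨hgo, hdo⟩ := hrun hnd'.1
        have hdo' : ∀ h ∈ o.g ::ₘ o.done, Geo oc vc reg R lc h := fun h hh => by
          rcases Multiset.mem_cons.1 hh with rfl | hh
          · exact hgo
          · exact hdo h hh
        obtain ⟨h1, h2⟩ := expand_geo hlink hhalf hocc hobs hvcc hlegs n _ o.rest hcard hdo' t' ht' hnd'.2
        exact ⟨h1, h2⟩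
    · rw [expand_of_not_nonempty Cov trig f c legs obs M h, Multiset.mem_singleton] at ht
      subst ht
      exact ⟨fun g hg => absurd hg (Multiset.notMem_zero _), hd⟩

/-- **Corollary** (from nothing set aside): for the integration by parts of a product of observables, every block
`X_c` and every remainder component `X_r` of every nondegenerate term is an `R`-connected set of cubes carrying all its
pending legs. [cite: BalabanImbrieJaffe1988, §5.14 p.311–312] -/
theorem expand_geo_init
    (hlink : ∀ p u w, (Cov p *ᵥ u) ⬝ᵥ w ≠ 0 → IsRConnected R (insert (lc u) (insert (lc w) (reg p))))
    (hhalf : ∀ p u, Cov p *ᵥ u ≠ 0 → IsRConnected R (insert (lc u) (reg p)))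
    (hocc : ∀ j, IsRConnected R (oc j)) (hobs : ∀ j, ∀ w ∈ obs j, lc w ∈ oc j)
    (hvcc : ∀ m, IsRConnected R (vc m)) (hlegs : ∀ m, ∀ w ∈ legs m, lc w ∈ vc m) (K : Finset κ) :
    ∀ t ∈ expand Cov trig f c legs obs M 0 K, NondegT t →
      (∀ g ∈ t.consts, Geo oc vc reg R lc g) ∧ ∀ g ∈ t.groups, Geo oc vc reg R lc g :=
  fun t ht hnd => expand_geo hlink hhalf hocc hobs hvcc hlegs _ 0 K (Nat.lt_succ_self _)
    (fun _ hh => absurd hh (Multiset.notMem_zero _)) t ht hnd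

/-- **The polymer form**: the cube set of every block of a nondegenerate term is `R`-connected.
[cite: BalabanImbrieJaffe1988, §5.14 p.311–312] -/
theorem isRConnected_cubes_of_mem_consts
    (hlink : ∀ p u w, (Cov p *ᵥ u) ⬝ᵥ w ≠ 0 → IsRConnected R (insert (lc u) (insert (lc w) (reg p))))
    (hhalf : ∀ p u, Cov p *ᵥ u ≠ 0 → IsRConnected R (insert (lc u) (reg p)))
    (hocc : ∀ j, IsRConnected R (oc j)) (hobs : ∀ j, ∀ w ∈ obs j, lc w ∈ oc j)
    (hvcc : ∀ m, IsRConnected R (vc m)) (hlegs : ∀ m, ∀ w ∈ legs m, lc w ∈ vc m) (K : Finset κ)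
    {t : WTerm S κ ι P} (ht : t ∈ expand Cov trig f c legs obs M 0 K) (hnd : NondegT t) {g : WGrp S κ ι P}
    (hg : g ∈ t.consts) : IsRConnected R (cubes oc vc reg g) :=
  ((expand_geo_init hlink hhalf hocc hobs hvcc hlegs K t ht hnd).1 g hg).1

/-- **The polymer form**: the cube set of every remainder component of a nondegenerate term is `R`-connected.
[cite: BalabanImbrieJaffe1988, §5.14 p.311–312] -/
theorem isRConnected_cubes_of_mem_groups
    (hlink : ∀ p u w, (Cov p *ᵥ u) ⬝ᵥ w ≠ 0 → IsRConnected R (insert (lc u) (insert (lc w) (reg p))))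
    (hhalf : ∀ p u, Cov p *ᵥ u ≠ 0 → IsRConnected R (insert (lc u) (reg p)))
    (hocc : ∀ j, IsRConnected R (oc j)) (hobs : ∀ j, ∀ w ∈ obs j, lc w ∈ oc j)
    (hvcc : ∀ m, IsRConnected R (vc m)) (hlegs : ∀ m, ∀ w ∈ legs m, lc w ∈ vc m) (K : Finset κ)
    {t : WTerm S κ ι P} (ht : t ∈ expand Cov trig f c legs obs M 0 K) (hnd : NondegT t) {g : WGrp S κ ι P}
    (hg : g ∈ t.groups) : IsRConnected R (cubes oc vc reg g) :=
  ((expand_geo_init hlink hhalf hocc hobs hvcc hlegs K t ht hnd).2 g hg).1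

end Geometry

end Literature.MathematicalPhysics.QuantumFieldTheory.BalabanImbrieJaffe1984to88.BIJ88WalkExpansionGeo311

end
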